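import Literature.AnabelianGeometry.SemiGraphs.TreeSystemBoundedGeodesics
import HarnessLib

/-!
# Bounded-distance fixed vertex systems: the dichotomy «adjacent ∨ compatible fixed edge-pair system»
([SemiAnbd] Thm. 3.7 (iii), p. 41)

Mochizuki, *Semi-graphs of anabelioids*, Publ. RIMS **42** (2006), Thm. 3.7 (iii), p. 41, with the
author's *Comments* (2020) (6). [cite: MochizukiSemiAnbd2006, Thm. 3.7(iii) p.41]

PROOF-ONLY (cell abc-iut, layer L3, GAP row G-t6g3-2 «Thm 3.7 (iii)/Cor 3.9 beyond finite 𝒢», sub-row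
G2·E2-bounded; seat abc-iut-w5-d160; no definition).  `TreeSystemBoundedGeodesics.lean` concludes
adjacency from bounded distance GIVEN the tree-level no-fixed-branch-pair-system input; the integrator of the
row (abc-iut-L3-t10, assembly `hadj_of_bddDist` over `TreeFixedSubjointSystemKill.lean`) asked for the
input-free DICHOTOMY instead, so that any estrangement kill (tree-level, or level-wise through immersions as
in `SemiGraph.eq_bot_of_fixedSubjointSystem` / `eq_bot_of_fixedEdgePairSystem`) can be plugged in
afterwards.  This file states it, in both currencies:

* `SemiGraph.adjacent_or_exists_fixedBranchPairSystem_of_bounded_dist` — bounded level distances ⇒ EITHER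
  at every level with `x j ≠ x' j` the two vertices are joined by a `C`-fixed edge, OR above some level
  there is a compatible system of `C`-fixed branch-pairs (the antecedents of `eq_bot_of_fixedSubjointSystem`);
* `SemiGraph.adjacent_or_exists_fixedEdgePairSystem_of_bounded_dist` — the same with the EDGE-pair form
  (the antecedents of `eq_bot_of_fixedEdgePairSystem`).

No group-theoretic input at all; nothing here is specific to anabelioids.
-/

namespace Literature.AnabelianGeometry.SemiGraphs

namespace SemiGraph

open CategoryTheory

universe v u

variable {P : Type u} [Group P] {J : Type v} [Preorder J]

/-- **Dichotomy, branch-pair form.**  For two compatible systems `x`, `x'` of `C`-fixed vertices of a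
system of trees with BOUNDED level distances: either at every level with `x j ≠ x' j` the two vertices are
joined by an edge fixed by `C`, or above some level `j₀` there is a compatible system of `C`-fixed
branch-pairs (the interior of the stabilised geodesics).  [cite: MochizukiSemiAnbd2006, Thm. 3.7(iii) p.41] -/
theorem adjacent_or_exists_fixedBranchPairSystem_of_bounded_dist (C : Subgroup P)
    (T : J → SemiGraph.{u}) (hT : ∀ j, (T j).IsTree) (ρ : ∀ j, P →* Aut (T j))
    (f : ∀ ⦃i j : J⦄, i ≤ j → (T j ⟶ T i)) (x x' : ∀ j, (T j).Vertex)
    (hx : ∀ ⦃i j : J⦄ (h : i ≤ j), (f h).vertexMap (x j) = x i)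
    (hx' : ∀ ⦃i j : J⦄ (h : i ≤ j), (f h).vertexMap (x' j) = x' i)
    (hfx : ∀ (j : J) (γ : C), (ρ j γ).hom.vertexMap (x j) = x j)
    (hfx' : ∀ (j : J) (γ : C), (ρ j γ).hom.vertexMap (x' j) = x' j)
    (hbdd : ∃ N : ℕ, ∀ j, (T j).subdivision.dist (Sum.inl (x j)) (Sum.inl (x' j)) ≤ N) :
    (∀ j, x j ≠ x' j → ∃ (e : (T j).Edge) (b b' : (T j).Branch), b ≠ b' ∧ (T j).edgeOf b = e ∧
      (T j).edgeOf b' = e ∧ (T j).abuts b = some (x j) ∧ (T j).abuts b' = some (x' j) ∧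
      ∀ γ : C, (ρ j γ).hom.edgeMap e = e) ∨
    ∃ (j₀ : J) (w : ∀ i : {i : J // j₀ ≤ i}, (T i.1).Vertex)
      (β β' : ∀ i : {i : J // j₀ ≤ i}, (T i.1).Branch),
      (∀ i, β i ≠ β' i ∧ (T i.1).abuts (β i) = some (w i) ∧ (T i.1).abuts (β' i) = some (w i)) ∧
      (∀ ⦃i i' : {i : J // j₀ ≤ i}⦄ (h : i.1 ≤ i'.1), (f h).vertexMap (w i') = w i ∧
        (f h).branchMap (β i') = β i ∧ (f h).branchMap (β' i') = β' i) ∧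
      (∀ (i : {i : J // j₀ ≤ i}) (γ : C), (ρ i.1 γ).hom.vertexMap (w i) = w i ∧
        (ρ i.1 γ).hom.branchMap (β i) = β i ∧ (ρ i.1 γ).hom.branchMap (β' i) = β' i) := by
  classical
  obtain ⟨N, hN⟩ := hbdd
  set ℓ : J → ℕ := fun j => (T j).subdivision.dist (Sum.inl (x j)) (Sum.inl (x' j)) with hℓ
  have hmono : ∀ ⦃i i' : J⦄, i ≤ i' → ℓ i ≤ ℓ i' := fun i i' h =>
    dist_le_dist_of_compatible T hT f x x' hx hx' h
  have hbdd' : BddAbove (Set.range ℓ) := ⟨N, by rintro _ ⟨i, rfl⟩; exact hN i⟩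
  by_cases hJ : Nonempty J
  · obtain ⟨j₁⟩ := hJ
    have hmem : sSup (Set.range ℓ) ∈ Set.range ℓ := Nat.sSup_mem ⟨ℓ j₁, j₁, rfl⟩ hbdd'
    obtain ⟨j₀, hj₀⟩ := hmem
    have hmax : ∀ i, ℓ i ≤ ℓ j₀ := fun i => hj₀ ▸ le_csSup hbdd' ⟨i, rfl⟩
    by_cases hM : 4 < ℓ j₀
    · right
      have hconst : ∀ i : J, j₀ ≤ i → ℓ i = ℓ j₀ := fun i hi => le_antisymm (hmax i) (hmono hi)
      exact ⟨j₀, exists_fixedBranchPairSystem_of_dist_eq C T hT ρ f x x' hx hx' hfx hfx' j₀ hconst hM⟩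
    · left
      intro j hne
      have hA : (T j).subdivision.IsAcyclic := (hT j).isTree.isAcyclic
      obtain ⟨p, hp⟩ :=
        (hT j).isTree.connected.exists_walk_length_eq_dist (Sum.inl (x j)) (Sum.inl (x' j))
      have hpath : p.IsPath := p.isPath_of_length_eq_dist hp
      have hlen : p.length = 4 := by
        have h1 := (path_inl_prefix hne p hpath).1
        have h2 : ℓ j ≤ 4 := (hmax j).trans (not_lt.mp hM)
        have h3 : p.length = ℓ j := hp
        omega
      obtain ⟨e, b, b', hbb', hbe, hb'e, hbx, hb'x, hx2⟩ := joins_of_path_length_four hne p hpath hlen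
      refine ⟨e, b, b', hbb', hbe, hb'e, hbx, hb'x, fun γ => ?_⟩
      have hfix := nodeMap_eq_self_of_isPath hA (ρ j γ) (x := Sum.inl (x j)) (y := Sum.inl (x' j))
        (by simp only [nodeMap, Sum.map_inl, hfx]) (by simp only [nodeMap, Sum.map_inl, hfx']) p hpath
        _ (p.getVert_mem_support 2)
      rw [hx2] at hfix
      exact Sum.inl_injective (Sum.inr_injective hfix)
  · left
    intro j
    exact absurd ⟨j⟩ hJ

/-- **Dichotomy, edge-pair form** (the interface of `SemiGraph.eq_bot_of_fixedEdgePairSystem`): bounded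
level distances ⇒ either adjacency by a `C`-fixed edge at every level with `x j ≠ x' j`, or above some level a
compatible system `(m; ε ≠ ε')` of vertices with two distinct `C`-fixed edges abutting to them.
[cite: MochizukiSemiAnbd2006, Thm. 3.7(iii) p.41] -/
theorem adjacent_or_exists_fixedEdgePairSystem_of_bounded_dist (C : Subgroup P)
    (T : J → SemiGraph.{u}) (hT : ∀ j, (T j).IsTree) (ρ : ∀ j, P →* Aut (T j))
    (f : ∀ ⦃i j : J⦄, i ≤ j → (T j ⟶ T i)) (x x' : ∀ j, (T j).Vertex)
    (hx : ∀ ⦃i j : J⦄ (h : i ≤ j), (f h).vertexMap (x j) = x i)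
    (hx' : ∀ ⦃i j : J⦄ (h : i ≤ j), (f h).vertexMap (x' j) = x' i)
    (hfx : ∀ (j : J) (γ : C), (ρ j γ).hom.vertexMap (x j) = x j)
    (hfx' : ∀ (j : J) (γ : C), (ρ j γ).hom.vertexMap (x' j) = x' j)
    (hbdd : ∃ N : ℕ, ∀ j, (T j).subdivision.dist (Sum.inl (x j)) (Sum.inl (x' j)) ≤ N) :
    (∀ j, x j ≠ x' j → ∃ (e : (T j).Edge) (b b' : (T j).Branch), b ≠ b' ∧ (T j).edgeOf b = e ∧
      (T j).edgeOf b' = e ∧ (T j).abuts b = some (x j) ∧ (T j).abuts b' = some (x' j) ∧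
      ∀ γ : C, (ρ j γ).hom.edgeMap e = e) ∨
    ∃ (j₀ : J) (m : ∀ i : {i : J // j₀ ≤ i}, (T i.1).Vertex)
      (ε ε' : ∀ i : {i : J // j₀ ≤ i}, (T i.1).Edge),
      (∀ i, ε i ≠ ε' i ∧ (T i.1).EdgeAbuts (ε i) (m i) ∧ (T i.1).EdgeAbuts (ε' i) (m i)) ∧
      (∀ ⦃i i' : {i : J // j₀ ≤ i}⦄ (h : i.1 ≤ i'.1), (f h).vertexMap (m i') = m i ∧
        (f h).edgeMap (ε i') = ε i ∧ (f h).edgeMap (ε' i') = ε' i) ∧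
      (∀ (i : {i : J // j₀ ≤ i}) (γ : C), (ρ i.1 γ).hom.vertexMap (m i) = m i ∧
        (ρ i.1 γ).hom.edgeMap (ε i) = ε i ∧ (ρ i.1 γ).hom.edgeMap (ε' i) = ε' i) := by
  classical
  obtain ⟨N, hN⟩ := hbdd
  set ℓ : J → ℕ := fun j => (T j).subdivision.dist (Sum.inl (x j)) (Sum.inl (x' j)) with hℓ
  have hmono : ∀ ⦃i i' : J⦄, i ≤ i' → ℓ i ≤ ℓ i' := fun i i' h =>
    dist_le_dist_of_compatible T hT f x x' hx hx' h
  have hbdd' : BddAbove (Set.range ℓ) := ⟨N, by rintro _ ⟨i, rfl⟩; exact hN i⟩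
  by_cases hJ : Nonempty J
  · obtain ⟨j₁⟩ := hJ
    have hmem : sSup (Set.range ℓ) ∈ Set.range ℓ := Nat.sSup_mem ⟨ℓ j₁, j₁, rfl⟩ hbdd'
    obtain ⟨j₀, hj₀⟩ := hmem
    have hmax : ∀ i, ℓ i ≤ ℓ j₀ := fun i => hj₀ ▸ le_csSup hbdd' ⟨i, rfl⟩
    by_cases hM : 4 < ℓ j₀
    · right
      have hconst : ∀ i : J, j₀ ≤ i → ℓ i = ℓ j₀ := fun i hi => le_antisymm (hmax i) (hmono hi)
      exact ⟨j₀, exists_fixedEdgePairSystem_of_dist_eq C T hT ρ f x x' hx hx' hfx hfx' j₀ hconst hM⟩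
    · left
      intro j hne
      have hA : (T j).subdivision.IsAcyclic := (hT j).isTree.isAcyclic
      obtain ⟨p, hp⟩ :=
        (hT j).isTree.connected.exists_walk_length_eq_dist (Sum.inl (x j)) (Sum.inl (x' j))
      have hpath : p.IsPath := p.isPath_of_length_eq_dist hp
      have hlen : p.length = 4 := by
        have h1 := (path_inl_prefix hne p hpath).1
        have h2 : ℓ j ≤ 4 := (hmax j).trans (not_lt.mp hM)
        have h3 : p.length = ℓ j := hp
        omega
      obtain ⟨e, b, b', hbb', hbe, hb'e, hbx, hb'x, hx2⟩ := joins_of_path_length_four hne p hpath hlen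
      refine ⟨e, b, b', hbb', hbe, hb'e, hbx, hb'x, fun γ => ?_⟩
      have hfix := nodeMap_eq_self_of_isPath hA (ρ j γ) (x := Sum.inl (x j)) (y := Sum.inl (x' j))
        (by simp only [nodeMap, Sum.map_inl, hfx]) (by simp only [nodeMap, Sum.map_inl, hfx']) p hpath
        _ (p.getVert_mem_support 2)
      rw [hx2] at hfix
      exact Sum.inl_injective (Sum.inr_injective hfix)
  · left
    intro j
    exact absurd ⟨j⟩ hJ

end SemiGraph

end Literature.AnabelianGeometry.SemiGraphs
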